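import Literature.Barriers.ValiantsHypothesis.AlgebraicNaturalProofsKRSTVNP
import Literature.Computability.AlgebraicComplexity.ConstantFreeDegree
import Literature.Computability.AlgebraicComplexity.UniversalCircuit
import Mathlib.NumberTheory.Chebyshev
import HarnessLib

/-!
# CKRST 2020 — *On the existence of algebraically natural proofs* (FOCS 2020, arXiv:2004.14147):
# Question 1.4, Theorems 1.6–1.9 (equations for `VP`/`VNP` with `{-1,0,1}` coefficients and over
# finite fields EXIST; "Thm 1.1–1.4" in the tree's earlier docstrings), the hitting-set /
# Chinese-remaindering / definability lemmas, Question 1.4 and §6 open questions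

Typed literature (cell val-lit t20, NP corpus; bears on route `BarrierLever`, rung V4). Honest
framing: `VP ≠ VNP` is NOT proved and nothing here is progress on it. The POSITIVE side of the
natural-proofs question: unconditionally there are `VP_ℂ`-constructible equations vanishing on the
coefficient vectors of all of `VP_ℂ` (even `VNP_ℂ`) RESTRICTED to polynomials with coefficients in
`{-1,0,1}`, and of all of `VP_𝔽`/`VNP_𝔽` over a finite field `𝔽` of constant size; "any such
separation of `VP` and `VNP` will have to rely on more fine grained information on the equations,
and not just their degree and algebraic circuit size" (§1.4).

**Versions and numbering (read this first).** Three printed versions: ECCC TR20-063 (= arXiv v1,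
2020), arXiv v2 (2021; = the held corpus text `paper:arxiv-2004.14147`, whose chunk locators
`pNNNN.txt:Ln` are used below and whose statements the extractor FLAT-numbers ‹Def 2›, ‹Lemma 11›, …
— the decl names `CKRST2020_lemma11` etc. carry these flat v2 numbers), arXiv v4 (2025, expanded and
merged with KRST 2022; TeX and page text checked in the cell's `HOME/lit/src/2004.14147/main.tex`,
`HOME/lit/pdftxt/CKRST2020/`). The four main theorems are **Theorems 1.6–1.9 in ALL three versions**
(restatables `MainThmComplex`, `MainThmFiniteFields`, `VNPboundedCoeff`, `VNPfiniteField`); the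
tree's `AlgebraicNaturalProofs.lean` and the cell's ledger call them "Thm 1.1–1.4" (their position
among the theorems of §1; FOCS-proceedings numbering unverified) and the decls are named
`CKRST2020_thm_1_1` … `_1_4` accordingly. Each docstring gives: printed number (v4 = v2 = ECCC for
§1), the v2 flat number with chunk locator, and the v4 / ECCC numbers of the lemmas. All explicit
constants quoted below were verified on the v4 page text (no token is a guess).

**Crosswalk (CITED, not restated).** Def. 1.2 (equation for `𝒞_{n,d}`) = nonzero `D` with
`∀ f ∈ 𝒞, eval (coeffVector M f) D = 0` = `IsNaturalProof M 𝒞 Set.univ D` (FSV Def. 1,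
`AlgebraicNaturalProofs.lean`); Def. 1.3 = `∃ D, IsNaturalProof M 𝒞 𝒟 D`; Def. 1.5 and v4 Defs.
2.15–2.19, Props. 2.17/2.20 ("`VP` has `VP`-natural proofs ⟺ `VP` does not have `VP`-succinct hitting
sets") = `IsSuccinctHittingSet`, `exists_isNaturalProof_iff`, `SuccinctHittingSetsForVP` (route crux
stmt-14610; an affirmative answer to Question 1.4 (frame `d = n`) refutes it:
`question4_frame_not_succinctHittingSetsForVP`); v2 ‹Defs 6–8› = v4 Defs. 2.5–2.14 (circuits,
exponential sums, `VP`, `VNP` "from first principles") = `complexity`, `boolSum`, `IsVPFamily`,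
`IsVNPFamily` (`ArithCircuit.lean`, `ValiantClasses.lean`), their fixed-`n` slices = `vpSlice` /
`vnpSlice` below with `SmallCircuits F n b = vpSlice F n n (n^b)`, `SmallDefinable F n b = vnpSlice F
n n (n^b)` (`rfl`); v2 ‹Lemma 9› = v4 Lemma 2.25 (universal circuit [Raz10]) =
`RazUniversal.exists_labels_of_complexity_le`, `RazUniversal.exists_eval_uCoeff_eq_coeff`, in the
[FSV18, Thm. 12] form `RazUniversal.exists_universalCircuit` (`UniversalCircuit.lean`; used by
`CKRST2020_lemma20_holds`); v2 ‹Lemma 10› = v4 Lemma 2.3 (polynomial identity lemma) = Mathlib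
`MvPolynomial.schwartz_zippel_totalDegree`;
v4 Lemma 2.30 (HSG from hardness [KI04]) = `kiGenerator_isHittingSetGenerator`; v4 Thms. 1.10 / 5.8
(conditional hardness of equations for `VNP`, i.e. KRST 2022) =
`succinctHittingSetsFromVNP_of_permanentExpHard` (`…KRSTVNP.lean`, PROVED); the `{-1,0,1}` slice =
`signCoeffSlice`; relative natural proofs = `IsNaturalProofRel` / `IsSuccinctHittingSetRel` /
`SuccinctHittingSetsForVPRel` (whose `signCoeffSlice` case Thm. 1.6 REFUTES:
`CKRST2020_thm_1_1.not_succinctHittingSetsForVPRel`). `VP`-natural proofs WITHOUT the coefficient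
bound = route item `NaturalProofsSeparateVNP` (stmt-18972) — NOT implied by anything here (v2 Remark
‹24› = ECCC Remark 5.9). v4 §6 adds: "a version of Theorem 1.6 which works for integer coefficients
with large magnitudes, say `exp((log N)^{log* N})`, will imply `VP`-natural proofs for all of `VP`" —
compare the route's PROVED `SuccinctHittingSetsIffIntegerSlice` (stmt-20029, magnitude `2^{n³}`).
v2 §6 (2) (equations for formulas / ABPs) is KRST 2022 Open Problem 2 (`KRST2022AsPrinted.lean`), not
duplicated. NOT typed here (follow-up EXTEND candidates): v4 Thms. 3.1–3.3 ([HS80a] rewordings),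
4.1–4.3 ("hitting sets give equations", the explicit constructions with printed size bounds
`10·q·N·t·log d` and `B⁴·t·N⁴`), 1.13 / 5.x (approximative hardness); [F14]'s Claims (v2 ‹17–18› =
v4 3.10–3.11, source not held).

**Reading of the family quantifiers (Thms. 1.6–1.9, Question 1.4).** arXiv v4 prints exactly the
per-exponent form typed here: "For every `t(n) = poly(n)`, for all large enough `n`, and every family
`{f_n} ∈ VP^ℂ`, where `f_n` is an `n`-variate, degree-`n^c`, size-`t(n)` polynomial with coefficients
in `{-1, 0, 1}`, we have that `P^{(c)}_N(coeff(f_n)) = 0`" (ONE family `P^{(c)}`; `t(n) = n^k` one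
`k` at a time; v2's wording "for all large `n` … for every family `{f_n} ∈ VP`" means the same by
§4's proof: "Fix a polynomial family `{f_n} ∈ VP` … let `k` be such that `f_n` is computable by size
`n^k` … for all large enough `n`"). `c` is an integer `≥ 1` (print "any constant `c > 0`";
TODO(general form): real `c`). Families are indexed by `n` (print: by `N(n) = binom(n + n^c, n)`,
injective in `n`). Size = the tree's fan-in-two `complexity` with constants in the ground field (v2
‹Def 7› / v4 §2.2 also allow constants from an extension field: a LARGER class, so each typed
vanishing clause is implied). Constructivity of the equations: print has `{P^{(c)}_N} ∈ VP^ℚ`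
(rational coefficients; v4, ECCC, and KRST 2022's restatement); TYPED over `ℂ` (`complexity` of a
complex polynomial family `≤ N^e`), which `VP^ℚ` implies by base change — weaker than print, all the
frame corollaries need; TODO(general form): `ℚ`-coefficients.

**Gate-model caveat.** Where a printed constant rests on [F14]'s circuit count (v2 ‹Lemmas 11, 16›
= v4 Lemmas 3.8–3.9, via v2 ‹Claims 17–18› = v4 Claims 3.10–3.11 = [F14, Lemmas 3.1.6, 3.2.13]: "at
most `(8 n |𝔽| s²)^s` polynomials of size `≤ s`"), the statement carries an absolute constant `C`
and the printed constant is quoted: the tree's `complexity` counts sum-gate coefficients and constant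
operands, which changes that count by `|𝔽|^{O(s)}`. ‹Lemma 21› [HY11a] is typed for `V = 𝔸^k` (the
case ‹Cor 22› uses; the tree has no degree of affine varieties). Marks: `-- FACT` (published,
unproved here), `-- DISCHARGED below` (a named fact with its `_holds` theorem in this file),
`-- OPEN-QUESTION` (neutral, never asserted), `-- PROVED`.

## References

* [ChatterjeeKumarRamyaSaptharishiTengse2020] P. Chatterjee, M. Kumar, C. Ramya, R. Saptharishi,
  A. Tengse, *On the existence of algebraically natural proofs*, FOCS 2020, 870–880; arXiv:2004.14147
  v2 (corpus; locators `paper:arxiv-2004.14147 pNNNN.txt:Ln` = 3000-char chunks) and v4; ECCC TR20-063.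
* [ForbesShpilkaVolk2018], [GrochowKumarSaksSaraf2017] (framework); [HeintzSchnorr1980] (‹L. 12›);
  [HrubesYehudayoff2011] (‹L. 21›); [Raz2010] (‹L. 9›); [KumarRamyaSaptharishiTengse2022] (`VNP` side).
-/

noncomputable section

namespace Literature.Barriers.ValiantsHypothesis

open Literature.Computability.AlgebraicComplexity MvPolynomial

/-! ### Coefficient spaces and the fixed-`n` slices of `VP`, `VNP` (v2 ‹Defs 2, 7, 8, 14›; v4 Defs.
1.2, 2.6, 2.11–2.12; ECCC Defs. 2.2–2.3, 5.1) -/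

section Slices

variable (F : Type*) [Field F]

/-- The monomial set `x^{≤ d}` (exponent vectors of degree `≤ d` in `n` variables); `|x^{≤ d}| =
N = binom(n + d, n)` indexes the coefficient vector `coeff(f)` (Def. 1.2 = v2 ‹Def 2›: "for
`N = binom(n+d, n)`, a nonzero polynomial `P_N(Z)` is said to be an equation for `𝒞_{n,d}` if for all
`f(x) ∈ 𝒞_{n,d}`, we have that `P_N(coeff(f)) = 0`"). At `d = n` it is the tree's `degLEMonomials n`.
[cite: ChatterjeeKumarRamyaSaptharishiTengse2020, Def. 1.2 (v2 ‹Def 2›)] locator: paper:arxiv-2004.14147 p0004.txt:L5 -/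
def monomialsDegLE (n d : ℕ) : Set (Fin n →₀ ℕ) :=
  {m | m.degree ≤ d}

/-- `monomialsDegLE n n = degLEMonomials n`. [cite: ChatterjeeKumarRamyaSaptharishiTengse2020, Def. 1.2] -/
theorem monomialsDegLE_self (n : ℕ) : monomialsDegLE n n = degLEMonomials n := rfl

/-- CKRST's `𝒞(n,d,s)` (v4: `Circuit_{d,s}(n)`) = the fixed-`n` slice of `VP_𝔽` (v2 ‹Def 7› "`VP`
and its slices" = ECCC Def. 2.2; v4 Defs. 2.7, 2.11): `n`-variate polynomials of total degree `≤ d`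
and fan-in-two circuit size `complexity f ≤ t`.
[cite: ChatterjeeKumarRamyaSaptharishiTengse2020, Def. 2.2 (ECCC) = v2 ‹Def 7› = Def. 2.11 (arXiv v4)] locator: paper:arxiv-2004.14147 p0008.txt:L22 -/
def vpSlice (n d t : ℕ) : Set (MvPolynomial (Fin n) F) :=
  {f | f.totalDegree ≤ d ∧ complexity f ≤ t}

/-- `SmallCircuits` is the `d = n`, `t = n^b` slice. [cite: ChatterjeeKumarRamyaSaptharishiTengse2020, Def. 2.11 (arXiv v4)] -/
theorem smallCircuits_eq_vpSlice (n b : ℕ) : SmallCircuits F n b = vpSlice F n n (n ^ b) := rfl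

/-- The fixed-`n` slice of `VNP_𝔽` (v2 ‹Def 8› = ECCC Def. 2.3, one exponent at a time: "for
`m ≤ n^{c₂}` there exists an `(n+m)`-variate polynomial `g_{n+m}(x,y)` of degree at most `n^{c₂}`
which has an algebraic circuit of size at most `n^{c₂}`, that satisfies `f_n(x) = Σ_{a ∈ {0,1}^m}
g_{n+m}(x,a)`"; v4 Defs. 2.6, 2.12 `ExpSum_{d,s}(n)`: exponential sums `Σ_{α ∈ {0,1}^{|y|}} C(x, α)` of
size `size(C) + |y|` and degree `deg C`, a polynomially equivalent bookkeeping): degree-`≤ d`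
polynomials `f = boolSum g` with `m ≤ t` auxiliary variables and `g` of size and degree `≤ t`.
[cite: ChatterjeeKumarRamyaSaptharishiTengse2020, Def. 2.3 (ECCC) = v2 ‹Def 8› ≈ Def. 2.12 (arXiv v4)] locator: paper:arxiv-2004.14147 p0008.txt:L45 -/
def vnpSlice (n d t : ℕ) : Set (MvPolynomial (Fin n) F) :=
  {f | f.totalDegree ≤ d ∧ ∃ m : ℕ, m ≤ t ∧ ∃ g : MvPolynomial (Fin n ⊕ Fin m) F,
      complexity g ≤ t ∧ g.totalDegree ≤ t ∧ f = boolSum g}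

/-- `SmallDefinable` (KRST Def. 3) is the `d = n`, `t = n^b` slice. [cite: ChatterjeeKumarRamyaSaptharishiTengse2020, Def. 2.3 (ECCC) = v2 ‹Def 8›] -/
theorem smallDefinable_eq_vnpSlice (n b : ℕ) : SmallDefinable F n b = vnpSlice F n n (n ^ b) := rfl

/-- **Definability (v2 ‹Def 14› = ECCC Def. 5.1).** "For `s ≥ 1`, a polynomial `f_n` is said to be
`s`-definable if there exists a polynomial `g_s ∈ 𝒞(s,s,s)` such that for `m = s - n`,
`f_n(x) = Σ_{α ∈ {0,1}^m} g_s(x, α)`" (`g_s` `s`-variate of degree and size `≤ s`); the clause `n ≤ s`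
makes `s - n` exact. v2 Remark ‹15› = ECCC Remark 5.2: every `{f_n} ∈ VNP` is `s(n)`-definable for a
polynomially bounded `s(n) > n`.
[cite: ChatterjeeKumarRamyaSaptharishiTengse2020, Def. 5.1 (ECCC) = v2 ‹Def 14›] locator: paper:arxiv-2004.14147 p0013.txt:L5 -/
def IsDefinable {n : ℕ} (s : ℕ) (f : MvPolynomial (Fin n) F) : Prop :=
  n ≤ s ∧ ∃ g : MvPolynomial (Fin n ⊕ Fin (s - n)) F,
    g.totalDegree ≤ s ∧ complexity g ≤ s ∧ f = boolSum g

/-- CKRST's `𝒟(n,d,s)`: `n`-variate, degree `≤ d`, `s`-definable polynomials (v2 ‹Def 14›; v4 Lemma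
3.9). [cite: ChatterjeeKumarRamyaSaptharishiTengse2020, Def. 5.1 (ECCC) = v2 ‹Def 14›] locator: paper:arxiv-2004.14147 p0013.txt:L10 -/
def definableSlice (n d s : ℕ) : Set (MvPolynomial (Fin n) F) :=
  {f | f.totalDegree ≤ d ∧ IsDefinable F s f}

end Slices

/-! ### §1.3, Theorems 1.6–1.9 as printed (the named facts `CKRST2020_thm_1_1` … `_1_4`): degree
`≤ n^c`, `N = binom(n + n^c, n)` coefficient variables; the tree-frame forms (`d = n`) are PROVED
corollaries in the next section -/

section AsPrinted

/-- **Theorem 1.6 as printed (`MainThmComplex`; the tree's/cell's "Thm 1.1").** arXiv v4: "Let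
`c > 0` be any constant. There is a polynomial family `{P^{(c)}_N} ∈ VP^ℚ` such that for
`N(n) = binom(n + n^c, n)`, the following are true. • For every `t(n) = poly(n)`, for all large enough
`n`, and every family `{f_n} ∈ VP^ℂ`, where `f_n` is an `n`-variate, degree-`n^c`, size-`t(n)`
polynomial with coefficients in `{-1, 0, 1}`, we have that `P^{(c)}_N(coeff(f_n)) = 0`, where
`coeff(f_n)` is the coefficient vector of `f_n`. • There exists a family `{h_n}` of `n` variate
polynomials and degree `≤ n^c` with coefficients in `{-1, 0, 1}` such that for all large enough `n`,
`P^{(c)}_N(coeff(h_n)) ≠ 0`." (= v2 / ECCC Thm. 1.6 up to the wording of the size quantifier.)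
Typed with `P` over `ℂ` of size and degree `≤ N^e` eventually (print: `VP^ℚ`, which implies it —
module docstring); vanishing per size exponent `k`. Print adds: it "holds for polynomials with
coefficients as large as `N`" and for `VP^ℝ`, `VP^ℚ` in place of `VP^ℂ` (not typed). LOAD-BEARING
(GAP row N3); tree-frame form PROVED below (`CKRST2020_thm_1_1.frame`).
[cite: ChatterjeeKumarRamyaSaptharishiTengse2020, Thm. 1.6 (arXiv v2/v4 = ECCC TR20-063; MainThmComplex)] locator: paper:arxiv-2004.14147 p0005.txt:L15 -/
-- FACT
def CKRST2020_thm_1_1 : Prop :=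
  ∀ c : ℕ, 1 ≤ c →
    ∃ (e : ℕ) (P : (n : ℕ) → MvPolynomial (monomialsDegLE n (n ^ c)) ℂ),
      (∃ n₀ : ℕ, ∀ n ≥ n₀, complexity (P n) ≤ ((n + n ^ c).choose n) ^ e ∧
        (P n).totalDegree ≤ ((n + n ^ c).choose n) ^ e) ∧
      (∀ k : ℕ, ∃ n₀ : ℕ, ∀ n ≥ n₀, ∀ f ∈ vpSlice ℂ n (n ^ c) (n ^ k), f ∈ signCoeffSlice ℂ n →
        eval (coeffVector (monomialsDegLE n (n ^ c)) f) (P n) = 0) ∧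
      (∃ n₀ : ℕ, ∀ n ≥ n₀, ∃ h ∈ signCoeffSlice ℂ n, h.totalDegree ≤ n ^ c ∧
        eval (coeffVector (monomialsDegLE n (n ^ c)) h) (P n) ≠ 0)

/-- **Theorem 1.7 as printed (`MainThmFiniteFields`; "Thm 1.2").** arXiv v4: "Let `𝔽` be any finite
field, and let `c > 0` be any constant. There is a polynomial family `{P^{(c)}_N} ∈ VP^𝔽` such that
for `N(n) = binom(n + n^c, n)`, the following are true. • For every `t(n) = poly(n)`, for all large
enough `n`, and every family `{f_n} ∈ VP^𝔽`, where `f_n` is an `n`-variate, degree-`n^c`, size-`t(n)`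
polynomial, we have that `P^{(c)}_N(coeff(f_n)) = 0`. • There exists a family `{h_n}` of `n` variate
polynomials and degree `≤ n^c` with coefficients in `𝔽` such that for all large enough `n`,
`P^{(c)}_N(coeff(h_n)) ≠ 0`." (v2 / ECCC: "any finite field of constant size".) Constructivity is
typed with `complexity` over `𝔽` (constants in `𝔽`), which the proof's formula
`P_N = OR(z)·Π_{a ∈ ℋ} Π_i (1 - (Σ_m z_m eval(a)^{(i)}_m)^{|𝔽|-1})` (v2 §3, p0010.txt:L19; v4 Thm. 4.1)
provides; v2 ‹Def 7›'s convention would also admit extension-field constants.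
[cite: ChatterjeeKumarRamyaSaptharishiTengse2020, Thm. 1.7 (arXiv v2/v4 = ECCC TR20-063; MainThmFiniteFields)] locator: paper:arxiv-2004.14147 p0005.txt:L37 -/
-- FACT
def CKRST2020_thm_1_2 (F : Type*) [Field F] [Fintype F] : Prop :=
  ∀ c : ℕ, 1 ≤ c →
    ∃ (e : ℕ) (P : (n : ℕ) → MvPolynomial (monomialsDegLE n (n ^ c)) F),
      (∃ n₀ : ℕ, ∀ n ≥ n₀, complexity (P n) ≤ ((n + n ^ c).choose n) ^ e ∧
        (P n).totalDegree ≤ ((n + n ^ c).choose n) ^ e) ∧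
      (∀ k : ℕ, ∃ n₀ : ℕ, ∀ n ≥ n₀, ∀ f ∈ vpSlice F n (n ^ c) (n ^ k),
        eval (coeffVector (monomialsDegLE n (n ^ c)) f) (P n) = 0) ∧
      (∃ n₀ : ℕ, ∀ n ≥ n₀, ∃ h : MvPolynomial (Fin n) F, h.totalDegree ≤ n ^ c ∧
        eval (coeffVector (monomialsDegLE n (n ^ c)) h) (P n) ≠ 0)

/-- **Theorem 1.8 as printed (`VNPboundedCoeff`; "Thm 1.3").** arXiv v4: "Let `c > 0` be any
constant. There is a polynomial family `{Q^{(c)}_N} ∈ VP^ℚ` such that for `N(n) = binom(n + n^c, n)`,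
the following are true. • For every `t(n) = poly(n)`, for all large enough `n`, and every family
`{f_n} ∈ VNP^ℂ`, where `f_n` is an `n`-variate, degree-`n^c`, size-`t(n)` polynomial with coefficients
in `{-1, 0, 1}`, we have that `Q^{(c)}_N(coeff(f_n)) = 0`. • There exists a family `{h_n}` of `n`
variate polynomials and `≤ n^c` with coefficients in `{-1, 0, 1}` such that for all large `n`,
`Q^{(c)}_N(coeff(h_n)) ≠ 0`." Typed with `Q` over `ℂ` (print `VP^ℚ` implies it); v2 Remark ‹24› =
ECCC Remark 5.9: these equations "seem to be different from" those of Thm. 1.6.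
[cite: ChatterjeeKumarRamyaSaptharishiTengse2020, Thm. 1.8 (arXiv v2/v4 = ECCC TR20-063; VNPboundedCoeff)] locator: paper:arxiv-2004.14147 p0005.txt:L56 -/
-- FACT
def CKRST2020_thm_1_3 : Prop :=
  ∀ c : ℕ, 1 ≤ c →
    ∃ (e : ℕ) (Q : (n : ℕ) → MvPolynomial (monomialsDegLE n (n ^ c)) ℂ),
      (∃ n₀ : ℕ, ∀ n ≥ n₀, complexity (Q n) ≤ ((n + n ^ c).choose n) ^ e ∧
        (Q n).totalDegree ≤ ((n + n ^ c).choose n) ^ e) ∧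
      (∀ k : ℕ, ∃ n₀ : ℕ, ∀ n ≥ n₀, ∀ f ∈ vnpSlice ℂ n (n ^ c) (n ^ k), f ∈ signCoeffSlice ℂ n →
        eval (coeffVector (monomialsDegLE n (n ^ c)) f) (Q n) = 0) ∧
      (∃ n₀ : ℕ, ∀ n ≥ n₀, ∃ h ∈ signCoeffSlice ℂ n, h.totalDegree ≤ n ^ c ∧
        eval (coeffVector (monomialsDegLE n (n ^ c)) h) (Q n) ≠ 0)

/-- **Theorem 1.9 as printed (`VNPfiniteField`; "Thm 1.4").** arXiv v4: "Let `𝔽` be any finite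
field and `c > 0` be any constant. There is a polynomial family `{Q^{(c)}_N} ∈ VP^𝔽` such that for
`N(n) = binom(n + n^c, n)`, the following are true. • For every `t(n) = poly(n)`, for all large enough
`n`, and every family `{f_n} ∈ VNP^𝔽`, where `f_n` is an `n`-variate, degree-`n^c`, size-`t(n)`
polynomial, we have that `Q^{(c)}_N(coeff(f_n)) = 0`. • There exists a family `{h_n}` of `n` variate
polynomials and degree `≤ n^c` with coefficients in `𝔽` such that for all large `n`,
`Q^{(c)}_N(coeff(h_n)) ≠ 0`." (constructivity over `𝔽` as in `CKRST2020_thm_1_2`).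
[cite: ChatterjeeKumarRamyaSaptharishiTengse2020, Thm. 1.9 (arXiv v2/v4 = ECCC TR20-063; VNPfiniteField)] locator: paper:arxiv-2004.14147 p0005.txt:L72 -/
-- FACT
def CKRST2020_thm_1_4 (F : Type*) [Field F] [Fintype F] : Prop :=
  ∀ c : ℕ, 1 ≤ c →
    ∃ (e : ℕ) (Q : (n : ℕ) → MvPolynomial (monomialsDegLE n (n ^ c)) F),
      (∃ n₀ : ℕ, ∀ n ≥ n₀, complexity (Q n) ≤ ((n + n ^ c).choose n) ^ e ∧
        (Q n).totalDegree ≤ ((n + n ^ c).choose n) ^ e) ∧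
      (∀ k : ℕ, ∃ n₀ : ℕ, ∀ n ≥ n₀, ∀ f ∈ vnpSlice F n (n ^ c) (n ^ k),
        eval (coeffVector (monomialsDegLE n (n ^ c)) f) (Q n) = 0) ∧
      (∃ n₀ : ℕ, ∀ n ≥ n₀, ∃ h : MvPolynomial (Fin n) F, h.totalDegree ≤ n ^ c ∧
        eval (coeffVector (monomialsDegLE n (n ^ c)) h) (Q n) ≠ 0)

end AsPrinted

/-! ### §1.3 in the tree's frame (`d = n`, `N = binom(2n, n)`, `Distinguishers F n a` = size and
degree `≤ N^a`): PROVED from the named facts at `c = 1` by transporting along `n ^ 1 = n` -/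

section Frame

variable {F : Type*} [Field F]

namespace CKRST2020

/-- The coefficient index sets agree at `c = 1`. [folklore] -/
private theorem monomialsDegLE_pow_one (n : ℕ) : monomialsDegLE n (n ^ 1) = degLEMonomials n := by
  rw [pow_one]; rfl

/-- Transport of a distinguisher from the `c = 1` coefficient variables to the tree's
`degLEMonomials n` (a renaming along `Equiv.setCongr`). [folklore] -/
def toFrame (n : ℕ) (Q : MvPolynomial (monomialsDegLE n (n ^ 1)) F) :
    MvPolynomial (degLEMonomials n) F :=
  rename (Equiv.setCongr (monomialsDegLE_pow_one n)) Q

/-- Evaluation at a coefficient vector is unchanged by the transport. [folklore] -/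
private theorem eval_coeffVector_toFrame (n : ℕ) (Q : MvPolynomial (monomialsDegLE n (n ^ 1)) F)
    (f : MvPolynomial (Fin n) F) :
    eval (coeffVector (degLEMonomials n) f) (toFrame n Q) =
      eval (coeffVector (monomialsDegLE n (n ^ 1)) f) Q := by
  rw [toFrame, eval_rename]; rfl

/-- The transport of a size-and-degree-`≤ binom(n + n^1, n)^e` polynomial is a level-`e`
distinguisher (`complexity_rename_of_injective_holds`, `totalDegree_rename_le`). [folklore] -/
private theorem toFrame_mem_distinguishers {n e : ℕ} {Q : MvPolynomial (monomialsDegLE n (n ^ 1)) F}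
    (hc : complexity Q ≤ ((n + n ^ 1).choose n) ^ e)
    (hd : Q.totalDegree ≤ ((n + n ^ 1).choose n) ^ e) : toFrame n Q ∈ Distinguishers F n e := by
  have hN : (n + n ^ 1).choose n = (2 * n).choose n := by rw [pow_one, two_mul]
  refine ⟨?_, ?_⟩
  · rw [toFrame, complexity_rename_of_injective_holds (Equiv.injective _) Q, ← hN]; exact hc
  · rw [← hN]; exact (totalDegree_rename_le _ _).trans hd

/-- **From `c = 1` as printed to the frame**: one family of transported distinguishers that is, for
every `b`, eventually a natural proof relative to `P n` against the degree-`n` class `𝒞 n n (n^b)`,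
with a non-vanishing witness of degree `≤ n` in `P n`. [folklore] -/
private theorem frame_of_degOne {P : ∀ n : ℕ, Set (MvPolynomial (Fin n) F)}
    {𝒞 : ∀ n d t : ℕ, Set (MvPolynomial (Fin n) F)}
    (h : ∃ (e : ℕ) (Q : (n : ℕ) → MvPolynomial (monomialsDegLE n (n ^ 1)) F),
      (∃ n₀ : ℕ, ∀ n ≥ n₀, complexity (Q n) ≤ ((n + n ^ 1).choose n) ^ e ∧
        (Q n).totalDegree ≤ ((n + n ^ 1).choose n) ^ e) ∧
      (∀ k : ℕ, ∃ n₀ : ℕ, ∀ n ≥ n₀, ∀ f ∈ 𝒞 n (n ^ 1) (n ^ k), f ∈ P n →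
        eval (coeffVector (monomialsDegLE n (n ^ 1)) f) (Q n) = 0) ∧
      (∃ n₀ : ℕ, ∀ n ≥ n₀, ∃ g ∈ P n, g.totalDegree ≤ n ^ 1 ∧
        eval (coeffVector (monomialsDegLE n (n ^ 1)) g) (Q n) ≠ 0)) :
    ∃ (a : ℕ) (D : (n : ℕ) → MvPolynomial (degLEMonomials n) F), ∀ b : ℕ, ∃ n₀ : ℕ, ∀ n ≥ n₀,
      IsNaturalProofRel (degLEMonomials n) (P n) (𝒞 n n (n ^ b)) (Distinguishers F n a) (D n) ∧
        ∃ g ∈ P n, g.totalDegree ≤ n ∧ eval (coeffVector (degLEMonomials n) g) (D n) ≠ 0 := by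
  obtain ⟨e, Q, ⟨n₁, hQ⟩, hvan, ⟨n₂, hwit⟩⟩ := h
  refine ⟨e, fun n => toFrame n (Q n), fun b => ?_⟩
  obtain ⟨n₃, hb⟩ := hvan b
  refine ⟨max (max n₁ n₂) n₃, fun n hn => ?_⟩
  have h1 : n₁ ≤ n := le_trans (le_trans (le_max_left _ _) (le_max_left _ _)) hn
  have h2 : n₂ ≤ n := le_trans (le_trans (le_max_right _ _) (le_max_left _ _)) hn
  have h3 : n₃ ≤ n := le_trans (le_max_right _ _) hn
  obtain ⟨g, hgP, hgdeg, hgne⟩ := hwit n h2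
  have hgne' : eval (coeffVector (degLEMonomials n) g) (toFrame n (Q n)) ≠ 0 := by
    rwa [eval_coeffVector_toFrame]
  refine ⟨⟨toFrame_mem_distinguishers (hQ n h1).1 (hQ n h1).2, ⟨g, hgP, hgne'⟩, ?_⟩,
    g, hgP, by simpa only [pow_one] using hgdeg, hgne'⟩
  intro f hf hfP
  rw [eval_coeffVector_toFrame]
  exact hb n h3 f (by simpa only [pow_one] using hf) hfP

end CKRST2020

/-- **Theorem 1.6 ("Thm 1.1"), frame `d = n`.** ONE family `D_n ∈ Distinguishers ℂ n a`
(`{P^{(1)}_N}`) which, for EVERY size exponent `b` and all large `n`, is a natural proof relative to the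
`{-1,0,1}` slice against `SmallCircuits ℂ n b` and is nonzero at some `{-1,0,1}`-coefficient `h` of
degree `≤ n`. [cite: ChatterjeeKumarRamyaSaptharishiTengse2020, Thm. 1.6 (MainThmComplex)] -/
-- PROVED (from the fact at `c = 1`)
theorem CKRST2020_thm_1_1.frame (hT : CKRST2020_thm_1_1) :
    ∃ (a : ℕ) (D : (n : ℕ) → MvPolynomial (degLEMonomials n) ℂ), ∀ b : ℕ, ∃ n₀ : ℕ, ∀ n ≥ n₀,
      IsNaturalProofRel (degLEMonomials n) (signCoeffSlice ℂ n) (SmallCircuits ℂ n b)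
          (Distinguishers ℂ n a) (D n) ∧
        ∃ h ∈ signCoeffSlice ℂ n, h.totalDegree ≤ n ∧
          eval (coeffVector (degLEMonomials n) h) (D n) ≠ 0 :=
  CKRST2020.frame_of_degOne (P := signCoeffSlice ℂ) (𝒞 := vpSlice ℂ) (hT 1 le_rfl)

/-- **Theorem 1.8 ("Thm 1.3"), frame `d = n`** (simple class `SmallDefinable ℂ n b`, the
`VNP`-succinct slice). [cite: ChatterjeeKumarRamyaSaptharishiTengse2020, Thm. 1.8 (VNPboundedCoeff)] -/
-- PROVED
theorem CKRST2020_thm_1_3.frame (hT : CKRST2020_thm_1_3) :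
    ∃ (a : ℕ) (D : (n : ℕ) → MvPolynomial (degLEMonomials n) ℂ), ∀ b : ℕ, ∃ n₀ : ℕ, ∀ n ≥ n₀,
      IsNaturalProofRel (degLEMonomials n) (signCoeffSlice ℂ n) (SmallDefinable ℂ n b)
          (Distinguishers ℂ n a) (D n) ∧
        ∃ h ∈ signCoeffSlice ℂ n, h.totalDegree ≤ n ∧
          eval (coeffVector (degLEMonomials n) h) (D n) ≠ 0 :=
  CKRST2020.frame_of_degOne (P := signCoeffSlice ℂ) (𝒞 := vnpSlice ℂ) (hT 1 le_rfl)

/-- Repackaging of the finite-field statements (no slice) into the relative frame at `P = ⊤`.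
[folklore] -/
private theorem CKRST2020.frame_of_degOne_univ {𝒞 : ∀ n d t : ℕ, Set (MvPolynomial (Fin n) F)}
    (h : ∃ (e : ℕ) (Q : (n : ℕ) → MvPolynomial (monomialsDegLE n (n ^ 1)) F),
      (∃ n₀ : ℕ, ∀ n ≥ n₀, complexity (Q n) ≤ ((n + n ^ 1).choose n) ^ e ∧
        (Q n).totalDegree ≤ ((n + n ^ 1).choose n) ^ e) ∧
      (∀ k : ℕ, ∃ n₀ : ℕ, ∀ n ≥ n₀, ∀ f ∈ 𝒞 n (n ^ 1) (n ^ k),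
        eval (coeffVector (monomialsDegLE n (n ^ 1)) f) (Q n) = 0) ∧
      (∃ n₀ : ℕ, ∀ n ≥ n₀, ∃ g : MvPolynomial (Fin n) F, g.totalDegree ≤ n ^ 1 ∧
        eval (coeffVector (monomialsDegLE n (n ^ 1)) g) (Q n) ≠ 0)) :
    ∃ (a : ℕ) (D : (n : ℕ) → MvPolynomial (degLEMonomials n) F), ∀ b : ℕ, ∃ n₀ : ℕ, ∀ n ≥ n₀,
      IsNaturalProofRel (degLEMonomials n) Set.univ (𝒞 n n (n ^ b)) (Distinguishers F n a) (D n) ∧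
        ∃ g : MvPolynomial (Fin n) F, g.totalDegree ≤ n ∧
          eval (coeffVector (degLEMonomials n) g) (D n) ≠ 0 := by
  obtain ⟨e, Q, hQ, hvan, ⟨n₂, hwit⟩⟩ := h
  obtain ⟨a, D, hD⟩ := CKRST2020.frame_of_degOne (F := F) (P := fun _ => Set.univ) (𝒞 := 𝒞)
    ⟨e, Q, hQ, fun k => (hvan k).imp fun n₀ hn₀ n hn f hf _ => hn₀ n hn f hf,
      ⟨n₂, fun n hn => (hwit n hn).imp fun g hg => ⟨Set.mem_univ g, hg⟩⟩⟩
  exact ⟨a, D, fun b => (hD b).imp fun n₀ hn₀ n hn =>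
    ⟨(hn₀ n hn).1, (hn₀ n hn).2.imp fun g hg => hg.2⟩⟩

/-- **Theorem 1.7 ("Thm 1.2"), frame `d = n`:** over a finite field, ONE family
`D_n ∈ Distinguishers F n a` vanishing, for every `b`, eventually, at EVERY member of
`SmallCircuits F n b`, nonzero at some degree-`≤ n` `h` AS A FUNCTION (stronger than `D_n ≠ 0` over
`𝔽_q`; `IsNaturalProofRel … Set.univ`). [cite: ChatterjeeKumarRamyaSaptharishiTengse2020, Thm. 1.7 (MainThmFiniteFields)] -/
-- PROVED
theorem CKRST2020_thm_1_2.frame [Fintype F] (hT : CKRST2020_thm_1_2 F) :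
    ∃ (a : ℕ) (D : (n : ℕ) → MvPolynomial (degLEMonomials n) F), ∀ b : ℕ, ∃ n₀ : ℕ, ∀ n ≥ n₀,
      IsNaturalProofRel (degLEMonomials n) Set.univ (SmallCircuits F n b) (Distinguishers F n a)
          (D n) ∧
        ∃ h : MvPolynomial (Fin n) F, h.totalDegree ≤ n ∧
          eval (coeffVector (degLEMonomials n) h) (D n) ≠ 0 :=
  CKRST2020.frame_of_degOne_univ (𝒞 := vpSlice F) (hT 1 le_rfl)

/-- **Theorem 1.9 ("Thm 1.4"), frame `d = n`** (simple class `SmallDefinable F n b`).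
[cite: ChatterjeeKumarRamyaSaptharishiTengse2020, Thm. 1.9 (VNPfiniteField)] -/
-- PROVED
theorem CKRST2020_thm_1_4.frame [Fintype F] (hT : CKRST2020_thm_1_4 F) :
    ∃ (a : ℕ) (D : (n : ℕ) → MvPolynomial (degLEMonomials n) F), ∀ b : ℕ, ∃ n₀ : ℕ, ∀ n ≥ n₀,
      IsNaturalProofRel (degLEMonomials n) Set.univ (SmallDefinable F n b) (Distinguishers F n a)
          (D n) ∧
        ∃ h : MvPolynomial (Fin n) F, h.totalDegree ≤ n ∧
          eval (coeffVector (degLEMonomials n) h) (D n) ≠ 0 :=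
  CKRST2020.frame_of_degOne_univ (𝒞 := vnpSlice F) (hT 1 le_rfl)

/-- The `∀ b, ∃ a` shape of Theorem 1.6 (the cell's GAP-LEDGER N3 wording).
[cite: ChatterjeeKumarRamyaSaptharishiTengse2020, Thm. 1.6 (MainThmComplex)] -/
-- PROVED
theorem CKRST2020_thm_1_1.forall_exists (hT : CKRST2020_thm_1_1) (b : ℕ) :
    ∃ a n₀ : ℕ, ∀ n ≥ n₀, ∃ D : MvPolynomial (degLEMonomials n) ℂ,
      IsNaturalProofRel (degLEMonomials n) (signCoeffSlice ℂ n) (SmallCircuits ℂ n b)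
          (Distinguishers ℂ n a) D ∧
        ∃ h ∈ signCoeffSlice ℂ n, h.totalDegree ≤ n ∧ eval (coeffVector (degLEMonomials n) h) D ≠ 0 := by
  obtain ⟨a, D, hD⟩ := hT.frame
  obtain ⟨n₀, hn₀⟩ := hD b
  exact ⟨a, n₀, fun n hn => ⟨D n, hn₀ n hn⟩⟩

/-- **Theorem 1.6 refutes the `{-1,0,1}`-relative hypothesis `SuccinctHittingSetsForVPRel ℂ
(signCoeffSlice ℂ)`** ("FALSE in print" in `AlgebraicNaturalProofs.lean`), by relative FSV Thm. 4
(`exists_isNaturalProofRel_iff`). [cite: ChatterjeeKumarRamyaSaptharishiTengse2020, Thm. 1.6 and §1.4] -/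
-- PROVED
theorem CKRST2020_thm_1_1.not_succinctHittingSetsForVPRel (hT : CKRST2020_thm_1_1) :
    ¬ SuccinctHittingSetsForVPRel ℂ (signCoeffSlice ℂ) := by
  intro hyp
  obtain ⟨a, D, hD⟩ := hT.frame
  obtain ⟨b, n₀, hb⟩ := hyp a
  obtain ⟨n₁, hn₁⟩ := hD b
  exact (exists_isNaturalProofRel_iff _ _ _ _).1 ⟨D _, (hn₁ (max n₀ n₁) (le_max_right _ _)).1⟩
    (hb (max n₀ n₁) (le_max_left _ _))

/-- Theorem 1.8: at one distinguisher level, for every `b`, eventually the `{-1,0,1}` members of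
the `VNP` slice `SmallDefinable ℂ n b` fail to hit. [cite: ChatterjeeKumarRamyaSaptharishiTengse2020, Thm. 1.8 (VNPboundedCoeff)] -/
-- PROVED
theorem CKRST2020_thm_1_3.not_isSuccinctHittingSetRel (hT : CKRST2020_thm_1_3) :
    ∃ a : ℕ, ∀ b : ℕ, ∃ n₀ : ℕ, ∀ n ≥ n₀,
      ¬ IsSuccinctHittingSetRel (degLEMonomials n) (signCoeffSlice ℂ n) (SmallDefinable ℂ n b)
        (Distinguishers ℂ n a) := by
  obtain ⟨a, D, hD⟩ := hT.frame
  refine ⟨a, fun b => ?_⟩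
  obtain ⟨n₀, hn₀⟩ := hD b
  exact ⟨n₀, fun n hn => (exists_isNaturalProofRel_iff _ _ _ _).1 ⟨D n, (hn₀ n hn).1⟩⟩

end Frame

/-! ### Question 1.4 (§1.2) and the §6 open questions — neutral `Prop`s, OPEN, never asserted -/

section OpenProblems

/-- **Question 1.4 (all versions; v2 ‹Question 4›), frame `d = n`** (OPEN QUESTION — not a fact):
"For every constant `c > 0`, does there exist a nonzero polynomial family `{P_{N,c}}` in `VP` such
that for all large enough `n`, the following is true? For every family of polynomials `{f_n}` in
`VP`, such that `f_n` is an `n` variate polynomial of degree `n^c`, `P_{N,c}` vanishes on the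
coefficient vector of `f_n` for `N = binom(n + n^c, n)`." At `c = 1`: ONE family `D_n` that is, for
every `b`, eventually, an (absolute) natural proof of level `a` against `SmallCircuits ℂ n b`. v2 §6
(1): "The most natural question here is to extend the results in this paper to the entire class `VP`
over all fields." [cite: ChatterjeeKumarRamyaSaptharishiTengse2020, Question 1.4 (v2 ‹Question 4›) and §6] locator: paper:arxiv-2004.14147 p0004.txt:L31 -/
-- OPEN-QUESTION
def CKRST2020_question4_frame : Prop :=
  ∃ (a : ℕ) (D : (n : ℕ) → MvPolynomial (degLEMonomials n) ℂ), ∀ b : ℕ, ∃ n₀ : ℕ, ∀ n ≥ n₀,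
    IsNaturalProof (degLEMonomials n) (SmallCircuits ℂ n b) (Distinguishers ℂ n a) (D n)

/-- An affirmative answer to Question 1.4 (frame `d = n`) refutes `SuccinctHittingSetsForVP ℂ` (FSV
Question 6, route crux stmt-14610), by FSV Thm. 4 (`exists_isNaturalProof_iff`; v4 Prop. 2.20 "`VP`
has `VP`-natural proofs ⟺ `VP` does not have `VP`-succinct hitting sets").
[cite: ChatterjeeKumarRamyaSaptharishiTengse2020, Question 1.4 and Def. 1.5 (v4 Prop. 2.20)] -/
-- PROVED
theorem question4_frame_not_succinctHittingSetsForVP (hQ : CKRST2020_question4_frame) :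
    ¬ SuccinctHittingSetsForVP ℂ := by
  intro hyp
  obtain ⟨a, D, hD⟩ := hQ
  obtain ⟨b, n₀, hb⟩ := hyp a
  obtain ⟨n₁, hn₁⟩ := hD b
  exact (exists_isNaturalProof_iff _ _ _).1 ⟨D _, hn₁ (max n₀ n₁) (le_max_right _ _)⟩
    (hb (max n₀ n₁) (le_max_left _ _))

/-- **v2 §6 (1), `VP⁰`** (OPEN QUESTION — not a fact): "A first step towards this generalization
would be to understand the complexity of equations for constant-free versions of the classes `VP`
and `VNP`, namely `VP⁰` and `VNP⁰`"; v4 §6: "A specific question could be to show that constant-free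
circuits (or formulas, ABPs) have efficient equations without any restrictions on coefficients."
Typed, frame `d = n`: `VP_ℂ`-constructible
equations vanishing, for every `b`, eventually, at (the complexified coefficient vector of) every
integer polynomial of degree `≤ n` with a constant-free circuit of size AND formal degree `≤ n^b`
(`HasTauDeg`, Bürgisser's `VP⁰` measures), nonzero at some integer polynomial of degree `≤ n`.
[cite: ChatterjeeKumarRamyaSaptharishiTengse2020, §6 (arXiv v2 and v4)] locator: paper:arxiv-2004.14147 p0016.txt:L5 -/
-- OPEN-QUESTION
def CKRST2020_openProblem_VP0 : Prop :=
  ∃ (a : ℕ) (D : (n : ℕ) → MvPolynomial (degLEMonomials n) ℂ), ∀ b : ℕ, ∃ n₀ : ℕ, ∀ n ≥ n₀,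
    D n ∈ Distinguishers ℂ n a ∧
      (∀ f : MvPolynomial (Fin n) ℤ, f.totalDegree ≤ n → HasTauDeg f (n ^ b) (n ^ b) →
        eval (coeffVector (degLEMonomials n) (map (Int.castRingHom ℂ) f)) (D n) = 0) ∧
      ∃ h : MvPolynomial (Fin n) ℤ, h.totalDegree ≤ n ∧
        eval (coeffVector (degLEMonomials n) (map (Int.castRingHom ℂ) h)) (D n) ≠ 0

/-- **v2 §6 (1), `VNP⁰`** (OPEN QUESTION — not a fact): the same with the simple class the Boolean
sums `boolSum g` of integer polynomials `g` in `n + u` variables, `u ≤ n^b`, with a constant-free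
circuit of size and formal degree `≤ n^b` (`VNP⁰` slices, Bürgisser 2009 Def. 2.8).
[cite: ChatterjeeKumarRamyaSaptharishiTengse2020, §6 (arXiv v2)] locator: paper:arxiv-2004.14147 p0016.txt:L5 -/
-- OPEN-QUESTION
def CKRST2020_openProblem_VNP0 : Prop :=
  ∃ (a : ℕ) (D : (n : ℕ) → MvPolynomial (degLEMonomials n) ℂ), ∀ b : ℕ, ∃ n₀ : ℕ, ∀ n ≥ n₀,
    D n ∈ Distinguishers ℂ n a ∧
      (∀ f : MvPolynomial (Fin n) ℤ, f.totalDegree ≤ n →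
        (∃ u : ℕ, u ≤ n ^ b ∧ ∃ g : MvPolynomial (Fin n ⊕ Fin u) ℤ,
          HasTauDeg g (n ^ b) (n ^ b) ∧ f = boolSum g) →
        eval (coeffVector (degLEMonomials n) (map (Int.castRingHom ℂ) f)) (D n) = 0) ∧
      ∃ h : MvPolynomial (Fin n) ℤ, h.totalDegree ≤ n ∧
        eval (coeffVector (degLEMonomials n) (map (Int.castRingHom ℂ) h)) (D n) ≠ 0

end OpenProblems

/-! ### v2 §3–§5: the ingredients (hitting sets, Chinese remaindering, definable polynomials); decl
names carry the v2 flat numbers, docstrings the printed v4 / ECCC numbers -/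

section Ingredients

/-- **v2 ‹Lemma 11› = arXiv v4 Lemma 3.8 = ECCC Lemma 3.1 (folklore; cf. [F14, Lemma 3.2.14]).**
"Let `𝔽` be a finite field with `|𝔽| ≥ d²`. Let `𝒞(n,d,s)` be the class of polynomials in
`𝔽[x₁,…,x_n]` of degree at most `d` that are computable by fan-in `2` algebraic circuits of size at
most `s`. Then, there is a non-explicit hitting set for `𝒞` of size at most
`⌈2s·(log n + 2 log s + 4)⌉`" (constant verified on the v4 page text). Typed with an absolute
constant `C` for the printed one (gate-model dependence via v4 Claim 3.10 = [F14, L. 3.1.6]: "at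
most `(8 n |𝔽| s²)^s` polynomials of size `≤ s`"; module docstring), for `n, s ≥ 1`.
[cite: ChatterjeeKumarRamyaSaptharishiTengse2020, Lemma 3.8 (arXiv v4) = Lemma 3.1 (ECCC) = v2 ‹Lemma 11›] locator: paper:arxiv-2004.14147 p0010.txt:L5 -/
-- FACT
def CKRST2020_lemma11 : Prop :=
  ∃ C : ℕ, ∀ (F : Type) [Field F] [Fintype F] (n d s : ℕ), 1 ≤ n → 1 ≤ s →
    d ^ 2 ≤ Fintype.card F →
      ∃ H : Finset (Fin n → F), H.card ≤ C * s * (Nat.log 2 n + Nat.log 2 s + 1) ∧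
        ∀ f ∈ vpSlice F n d s, f ≠ 0 → ∃ x ∈ H, eval x f ≠ 0

/-- **v2 ‹Lemma 12› (hitting sets for efficiently computable polynomials [HS80]).** "There are
(non-explicit) hitting sets `ℋ` for `𝒞(n,d,s)` (the set of all `n`-variate polynomials with degree at
most `d` that are computable by algebraic circuits of size at most `s`), such that `ℋ ⊂ [(sd)²]^n` and
`|ℋ| = poly(s)`" (over `ℂ`, §4). Typed: one exponent `e`, `|ℋ| ≤ s^e`, in the paper's regime
`1 ≤ n ≤ s`, `1 ≤ d ≤ s`, `s ≥ 2`; `[(sd)²] = {1,…,(sd)²}`. arXiv v4 restates it as Lemma 3.6: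
"There are constants `c` and `e` such that … `ℋ ⊂ [(nds)^c]^n` and `|ℋ| = (nds)^e`".
[cite: ChatterjeeKumarRamyaSaptharishiTengse2020, v2 ‹Lemma 12› (§4); cf. Lemma 3.6 (arXiv v4)] locator: paper:arxiv-2004.14147 p0011.txt:L7 -/
-- FACT
def CKRST2020_lemma12 : Prop :=
  ∃ e : ℕ, ∀ n d s : ℕ, 1 ≤ n → n ≤ s → 1 ≤ d → d ≤ s → 2 ≤ s →
    ∃ H : Finset (Fin n → ℤ), (∀ x ∈ H, ∀ i, 1 ≤ x i ∧ x i ≤ ((s * d) ^ 2 : ℕ)) ∧ H.card ≤ s ^ e ∧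
      ∀ f ∈ vpSlice ℂ n d s, f ≠ 0 → ∃ x ∈ H, eval (fun i => (x i : ℂ)) f ≠ 0

/-- **v2 ‹Claim 13› = arXiv v4 Claim 4.4 = ECCC Claim 4.4 (Chinese remaindering).** v2: "Suppose
`f` is a polynomial with integer coefficients, and `a ∈ ℤ^n`. If `f(a) ≠ 0` and `|f(a)| ≤ M`, then
there is some `r ≤ O((log M)²)` such that `⟨coeff(f), ~eval_r(a)⟩ ≠ 0`", where
`~eval_r(a)_m := m(a) mod r ∈ {0,…,r-1}` (proof: `ℓ = log(M+1)`, "there is some prime `r ≤ ℓ²` such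
that `f(a) ≢ 0 mod r`"; v4 prints the bound as `r ≤ 2(log M)²` and the conclusion `≢ 0 mod r`, which
implies `≠ 0`). Typed in v2's form with an absolute constant in the `O(·)`, `r ≥ 2` (excluding the
degenerate moduli `0, 1`), and `⟨coeff(f), ~eval_r(a)⟩ = Σ_{m ∈ supp f} coeff_m(f)·(a^m mod r)`.
[cite: ChatterjeeKumarRamyaSaptharishiTengse2020, Claim 4.4 (arXiv v4 = ECCC) = v2 ‹Claim 13›] locator: paper:arxiv-2004.14147 p0011.txt:L32 -/
-- FACT, DISCHARGED below (`CKRST2020_claim13_holds`)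
def CKRST2020_claim13 : Prop :=
  ∃ C : ℕ, ∀ (n : ℕ) (f : MvPolynomial (Fin n) ℤ) (a : Fin n → ℤ) (M : ℕ),
    eval a f ≠ 0 → |eval a f| ≤ M →
      ∃ r : ℕ, 2 ≤ r ∧ r ≤ C * (Nat.log 2 M + 1) ^ 2 ∧
        (∑ m ∈ f.support, coeff m f * ((∏ i, a i ^ m i) % (r : ℤ))) ≠ 0

/-- **v2 ‹Lemma 16› = arXiv v4 Lemma 3.9 = ECCC Lemma 5.3** ("a slight modification of [F14, Lemma
3.2.14]"). "Let `𝔽` be a finite field with `|𝔽| ≥ d²`. Let `𝒟(n,d,s)` be the class of polynomials in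
`𝔽[x₁,…,x_n]` of degree at most `d` that are `s`-definable. Then, there is a non-explicit hitting set
`ℋ` for `𝒟(n,d,s)` of size at most `⌈2s·(3 log s + 4)⌉`" (constant verified on the v4 page text; via
v4 Claims 3.10–3.11 = [F14, L. 3.1.6, 3.2.13]: "`|𝒟(n,d,s)| ≤ (8|𝔽|s³)^s`", and a finite class of
degree `< d` over `|𝔽| ≥ (1+ε)d` has a hitting set of size `≤ ⌈log_{1+ε} |𝒞|⌉`). Typed with an
absolute constant (gate model, module docstring), `s ≥ 1`.
[cite: ChatterjeeKumarRamyaSaptharishiTengse2020, Lemma 3.9 (arXiv v4) = Lemma 5.3 (ECCC) = v2 ‹Lemma 16›] locator: paper:arxiv-2004.14147 p0013.txt:L19 -/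
-- FACT
def CKRST2020_lemma16 : Prop :=
  ∃ C : ℕ, ∀ (F : Type) [Field F] [Fintype F] (n d s : ℕ), 1 ≤ s → d ^ 2 ≤ Fintype.card F →
    ∃ H : Finset (Fin n → F), H.card ≤ C * s * (Nat.log 2 s + 1) ∧
      ∀ f ∈ definableSlice F n d s, f ≠ 0 → ∃ x ∈ H, eval x f ≠ 0

/-- **v2 ‹Lemma 19› = ECCC Lemma 5.6 (coefficient vectors of definable polynomials)**, the identity
in its proof: "Let `f` be an `n`-variate polynomial of degree `d` that is `s`-definable. Then there
exists an `s`-variate polynomial `g` and a linear map `L_{n,d,s}`, such that `coeff(f) = L(coeff(g))`.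
Furthermore, the map `L` depends solely on `n`, `d` and `s`", with `L_e(coeff(g)) = Σ_{w^a ∈ w^{≤ s}}
2^{m - |supp a|}·coeff_{x^e w^a}(g)` (since `Σ_{α ∈ {0,1}^m} α^a = 2^{m - |supp a|}`). Typed as the
coefficient formula of `boolSum` over any commutative semiring (v4 replaces it by Claim 3.4 / Lemma
3.5). [cite: ChatterjeeKumarRamyaSaptharishiTengse2020, Lemma 5.6 (ECCC) = v2 ‹Lemma 19›] locator: paper:arxiv-2004.14147 p0013.txt:L53 -/
-- DISCHARGED below (`CKRST2020_lemma19_holds`)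
def CKRST2020_lemma19 (F : Type*) [CommSemiring F] : Prop :=
  ∀ (n m : ℕ) (g : MvPolynomial (Fin n ⊕ Fin m) F) (e : Fin n →₀ ℕ),
    coeff e (boolSum g) =
      ∑ ν ∈ g.support, if (Finsupp.sumFinsuppEquivProdFinsupp ν).1 = e then
        (2 : F) ^ (m - (Finsupp.sumFinsuppEquivProdFinsupp ν).2.support.card) * coeff ν g else 0

/-- **v2 ‹Lemma 20› = ECCC Lemma 5.7 (universal map for definable polynomials) = arXiv v4 Lemma 3.5
(universal polynomial for exponential sums).** "Let `s ≥ n ≥ 1` and `d ≥ 0`. Then for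
`N = binom(n+d, n)` there exists a polynomial map `𝒰(y) : ℂ^r → ℂ^N` with `r ≤ poly(n,d,s)` such
that: • `deg(𝒰(y)) ≤ poly(s)`; • for any `f ∈ ℂ[x₁,…,x_n]` with `deg_x(f) ≤ d` that is `s`-definable,
there exists an `a ∈ ℂ^r` such that `coeff(f) = 𝒰(a)`." Typed with one exponent `e` (`r ≤ s^e`,
degrees `≤ s^e`; `n ≤ s`, and `d ≤ s` may be assumed for `s`-definable `f`), `s ≥ 2`.
[cite: ChatterjeeKumarRamyaSaptharishiTengse2020, Lemma 5.7 (ECCC) = v2 ‹Lemma 20› = Lemma 3.5 (arXiv v4)] locator: paper:arxiv-2004.14147 p0013.txt:L79 -/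
-- FACT, DISCHARGED below (`CKRST2020_lemma20_holds`)
def CKRST2020_lemma20 : Prop :=
  ∃ e : ℕ, ∀ n d s : ℕ, 1 ≤ n → n ≤ s → 2 ≤ s →
    ∃ (r : ℕ) (U : monomialsDegLE n d → MvPolynomial (Fin r) ℂ), r ≤ s ^ e ∧
      (∀ μ, (U μ).totalDegree ≤ s ^ e) ∧
      ∀ f ∈ definableSlice ℂ n d s, ∃ y : Fin r → ℂ, ∀ μ, eval y (U μ) = coeffVector _ f μ

/-- **v2 ‹Lemma 21› = ECCC Lemma 4.1 ([HY11a, Claim 3.6], "a slight modification"), case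
`V = 𝔸^k`.** Print (ECCC): "Let `V ⊆ ℂ^n` be an irreducible algebraic variety of dimension `k` and
degree `r`. Suppose `F = (F_1,…,F_m)` with `F_i ∈ 𝔽[x₁,…,x_n]^{≤ d}` is a polynomial map. Then, for
`Δ ⊂ ℤ`, `|F(V) ∩ Δ^m| ≤ r·(|Δ|·d)^k`." Typed for `V = ℂ^k` (dimension `k`, degree `1`; the case v2
‹Cor 22› uses), `Δ ⊂ ℤ` finite nonempty, `d ≥ 1` (implicit in print; `encard` also asserts
finiteness). Superseded in v4 by [HS80a] (Lemmas 2.32–2.33). TODO(general form): irreducible `V` of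
dimension `k`, degree `r` (no degree of affine varieties in the tree).
[cite: ChatterjeeKumarRamyaSaptharishiTengse2020, Lemma 4.1 (ECCC) = v2 ‹Lemma 21›] locator: paper:arxiv-2004.14147 p0014.txt:L17 -/
-- FACT
def CKRST2020_lemma21_affineSpace : Prop :=
  ∀ (k m d : ℕ) (F : Fin m → MvPolynomial (Fin k) ℂ) (Δ : Finset ℤ), Δ.Nonempty → 1 ≤ d →
    (∀ i, (F i).totalDegree ≤ d) →
      {v : Fin m → ℂ | (∀ i, ∃ z ∈ Δ, v i = (z : ℂ)) ∧ ∃ y : Fin k → ℂ, ∀ i, eval y (F i) = v i}.encard ≤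
        ((Δ.card * d) ^ k : ℕ)

/-- **v2 ‹Cor 22› (cf. ECCC Cor. 4.2, the same count for circuits).** "The number of polynomials with
coefficients in `Δ ⊂ ℤ` that are `s`-definable is at most `(|Δ|·s)^{poly(s)}`." Typed with one
exponent `e`, over CKRST's `𝒟(n,d,s)`, `Δ ⊂ ℤ` finite nonempty, `s ≥ 2`. "Coefficients in `Δ`"
is typed for ALL coefficients `coeff_μ f`, the zero ones included, so for `n ≥ 1` the counted set is
nonempty only when `0 ∈ Δ` (print's `Δ = {-1, 0, 1}`; val-lit-ref-3).
[cite: ChatterjeeKumarRamyaSaptharishiTengse2020, v2 ‹Cor 22› (§5.2); cf. Cor. 4.2 (ECCC)] locator: paper:arxiv-2004.14147 p0014.txt:L44 -/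
-- FACT
def CKRST2020_cor22 : Prop :=
  ∃ e : ℕ, ∀ (n d s : ℕ) (Δ : Finset ℤ), Δ.Nonempty → 2 ≤ s →
    {f : MvPolynomial (Fin n) ℂ | f ∈ definableSlice ℂ n d s ∧
        ∀ μ, ∃ z ∈ Δ, coeff μ f = (z : ℂ)}.encard ≤ ((Δ.card * s) ^ (s ^ e) : ℕ)

/-- **v2 ‹Lemma 23› = ECCC Lemma 5.8 (hitting sets for efficiently definable polynomials).** "Let
`Δ ⊂ ℤ`. There are (non-explicit) hitting sets `ℋ` for `𝒟(n,d,s)` (the set of all `n`-variate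
polynomials with degree at most `d` that are `s`-definable) with coefficients in `Δ`, such that
`ℋ ⊂ [d·s·|Δ|]^n` and `|ℋ| = poly(s)`." Typed with one exponent `e`, `Δ ⊂ ℤ` finite nonempty,
`1 ≤ n ≤ s`, `1 ≤ d`, `s ≥ 2`; "coefficients in `Δ`" is typed for ALL coefficients (zeros included),
so for `n ≥ 1` the coefficient hypothesis is satisfiable only when `0 ∈ Δ` (print's
`Δ = {-1, 0, 1}`; val-lit-ref-3). arXiv v4 Lemma 3.7 drops the coefficient restriction ("constants `c′`,
`e′` … `ℋ ⊂ [(nds)^{c′}]^n` and `|ℋ| = (nds)^{e′}`", via [HS80a]).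
[cite: ChatterjeeKumarRamyaSaptharishiTengse2020, Lemma 5.8 (ECCC) = v2 ‹Lemma 23›; cf. Lemma 3.7 (arXiv v4)] locator: paper:arxiv-2004.14147 p0014.txt:L59 -/
-- FACT
def CKRST2020_lemma23 : Prop :=
  ∃ e : ℕ, ∀ (n d s : ℕ) (Δ : Finset ℤ), Δ.Nonempty → 1 ≤ n → n ≤ s → 1 ≤ d → 2 ≤ s →
    ∃ H : Finset (Fin n → ℤ), (∀ x ∈ H, ∀ i, 1 ≤ x i ∧ x i ≤ ((d * s * Δ.card : ℕ) : ℤ)) ∧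
      H.card ≤ s ^ e ∧
      ∀ f ∈ definableSlice ℂ n d s, (∀ μ, ∃ z ∈ Δ, coeff μ f = (z : ℂ)) → f ≠ 0 →
        ∃ x ∈ H, eval (fun i => (x i : ℂ)) f ≠ 0

end Ingredients

/-! ### Discharge of `CKRST2020_lemma19` (the `boolSum` coefficient identity) -/

section Lemma19Proof

variable {F : Type*} [CommSemiring F]

namespace CKRST2020

/-- `Σ_{α ∈ {0,1}^m} [α is true on T] = 2^{m - |T|}` (the count behind `Σ_α α^a = 2^{m - |supp a|}`).
[cite: ChatterjeeKumarRamyaSaptharishiTengse2020, Lemma 5.6 (ECCC) = v2 ‹Lemma 19›, proof] -/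
private theorem sum_boole_forall_mem {m : ℕ} (T : Finset (Fin m)) :
    ∑ e' : Fin m → Bool, (if (∀ y ∈ T, e' y = true) then (1 : F) else 0) = 2 ^ (m - T.card) := by
  classical
  have hw : ∀ e' : Fin m → Bool, (if (∀ y ∈ T, e' y = true) then (1 : F) else 0) =
      ∏ y, (if y ∈ T then (if e' y = true then (1 : F) else 0) else 1) := by
    intro e'
    simp only [Finset.prod_ite_mem, Finset.univ_inter, Finset.prod_boole]
    convert rfl
  have key : ∏ y : Fin m, ∑ b : Bool, (if y ∈ T then (if b = true then (1 : F) else 0) else 1) =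
      ∑ e' : Fin m → Bool, ∏ y, (if y ∈ T then (if e' y = true then (1 : F) else 0) else 1) := by
    rw [Finset.prod_univ_sum, Fintype.piFinset_univ]
  calc ∑ e' : Fin m → Bool, (if (∀ y ∈ T, e' y = true) then (1 : F) else 0)
      = ∑ e' : Fin m → Bool, ∏ y, (if y ∈ T then (if e' y = true then (1 : F) else 0) else 1) :=
        Finset.sum_congr rfl (fun e' _ => hw e')
    _ = ∏ y : Fin m, ∑ b : Bool, (if y ∈ T then (if b = true then (1 : F) else 0) else 1) :=
        key.symm
    _ = ∏ y : Fin m, (if y ∈ T then (1 : F) else 2) := by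
        refine Finset.prod_congr rfl (fun y _ => ?_)
        rw [Fintype.sum_bool]
        by_cases h : y ∈ T <;> simp [h, one_add_one_eq_two]
    _ = 2 ^ (m - T.card) := by
        rw [Finset.prod_ite, Finset.prod_const_one, one_mul, Finset.prod_const]
        congr 1
        have : (Finset.univ.filter fun y : Fin m => ¬ y ∈ T) = Tᶜ := by
          ext y; simp
        rw [this, Finset.card_compl, Fintype.card_fin]

/-- The contribution of one monomial `c · x^{ν₁} w^{ν₂}` of `g` to `coeff_e (boolSum g)`:
`[ν₁ = e] · 2^{m - |supp ν₂|} · c`. [cite: ChatterjeeKumarRamyaSaptharishiTengse2020, Lemma 5.6 (ECCC) = v2 ‹Lemma 19›, proof] -/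
private theorem sum_coeff_aeval_monomial {n m : ℕ} (e : Fin n →₀ ℕ) (ν : Fin n ⊕ Fin m →₀ ℕ)
    (c : F) :
    ∑ e' : Fin m → Bool, coeff e (aeval (Sum.elim X fun j => if e' j then
        (1 : MvPolynomial (Fin n) F) else 0) (monomial ν c)) =
      if (Finsupp.sumFinsuppEquivProdFinsupp ν).1 = e then
        (2 : F) ^ (m - (Finsupp.sumFinsuppEquivProdFinsupp ν).2.support.card) * c else 0 := by
  classical
  set ν₁ := (Finsupp.sumFinsuppEquivProdFinsupp ν).1 with hν₁
  set ν₂ := (Finsupp.sumFinsuppEquivProdFinsupp ν).2 with hν₂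
  have hTL : ν.support.toLeft = ν₁.support := by
    ext x; simp [hν₁, Finsupp.mem_support_iff]
  have hTR : ν.support.toRight = ν₂.support := by
    ext y; simp [hν₂, Finsupp.mem_support_iff]
  -- Step A: the monomial at a Boolean point of the auxiliary variables
  have hA : ∀ e' : Fin m → Bool,
      aeval (Sum.elim X fun j => if e' j then (1 : MvPolynomial (Fin n) F) else 0) (monomial ν c) =
        if (∀ y ∈ ν₂.support, e' y = true) then monomial ν₁ c else 0 := by
    intro e'
    rw [aeval_monomial, Finsupp.prod, ← Finset.toLeft_disjSum_toRight (u := ν.support),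
      Finset.prod_disjSum]
    simp only [Sum.elim_inl, Sum.elim_inr]
    have hL : ∏ x ∈ ν.support.toLeft, (X x : MvPolynomial (Fin n) F) ^ ν (Sum.inl x) =
        ν₁.prod fun x k => X x ^ k := by
      rw [Finsupp.prod, hTL]
      refine Finset.prod_congr rfl (fun x _ => ?_)
      rw [hν₁, Finsupp.fst_sumFinsuppEquivProdFinsupp]
    rw [hL, MvPolynomial.algebraMap_eq]
    split_ifs with h
    · have h1 : ∏ x ∈ ν.support.toRight,
          ((if e' x = true then (1 : MvPolynomial (Fin n) F) else 0) ^ ν (Sum.inr x)) = 1 := by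
        refine Finset.prod_eq_one (fun y hy => ?_)
        rw [hTR] at hy
        simp [h y hy]
      rw [h1, mul_one, ← monomial_eq]
    · push Not at h
      obtain ⟨y, hy, hfalse⟩ := h
      have hne : ν (Sum.inr y) ≠ 0 := by
        simpa [hν₂, Finsupp.mem_support_iff] using hy
      have h0 : ∏ x ∈ ν.support.toRight,
          ((if e' x = true then (1 : MvPolynomial (Fin n) F) else 0) ^ ν (Sum.inr x)) = 0 :=
        Finset.prod_eq_zero (i := y) (by rwa [hTR]) (by simp [hfalse, hne])
      rw [h0, mul_zero, mul_zero]
  -- Step B: read off the coefficient of `x^e` and count the Boolean points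
  simp_rw [hA, apply_ite (coeff e), coeff_monomial, coeff_zero]
  by_cases hν : ν₁ = e
  · simp only [hν, if_true]
    calc ∑ e' : Fin m → Bool, (if (∀ y ∈ ν₂.support, e' y = true) then c else 0)
        = ∑ e' : Fin m → Bool, (if (∀ y ∈ ν₂.support, e' y = true) then (1 : F) else 0) * c :=
          Finset.sum_congr rfl (fun e' _ => by split_ifs <;> simp)
      _ = (2 : F) ^ (m - ν₂.support.card) * c := by
          rw [← Finset.sum_mul, sum_boole_forall_mem]
  · simp [hν]

end CKRST2020

/-- **Discharge of `CKRST2020_lemma19`** (the coefficient identity behind v2 ‹Lemma 19› = ECCC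
Lemma 5.6): `coeff_e (Σ_{α ∈ {0,1}^m} g(x, α)) = Σ_{(e,a) ∈ supp g} 2^{m - |supp a|} coeff_{x^e w^a} g`,
by expanding `g` into monomials, evaluating each at a Boolean point of the auxiliary variables, and
counting the Boolean points that are `1` on `supp a`.
[cite: ChatterjeeKumarRamyaSaptharishiTengse2020, Lemma 5.6 (ECCC) = v2 ‹Lemma 19›] -/
theorem CKRST2020_lemma19_holds (F : Type*) [CommSemiring F] : CKRST2020_lemma19 F := by
  classical
  intro n m g e
  have hg := g.as_sum
  calc coeff e (boolSum g)
      = ∑ e' : Fin m → Bool, ∑ ν ∈ g.support, coeff e (aeval (Sum.elim X fun j => if e' j then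
          (1 : MvPolynomial (Fin n) F) else 0) (monomial ν (coeff ν g))) := by
        simp only [boolSum, coeff_sum]
        refine Finset.sum_congr rfl (fun e' _ => ?_)
        conv_lhs => rw [hg]
        rw [map_sum, coeff_sum]
    _ = ∑ ν ∈ g.support, ∑ e' : Fin m → Bool, coeff e (aeval (Sum.elim X fun j => if e' j then
          (1 : MvPolynomial (Fin n) F) else 0) (monomial ν (coeff ν g))) := Finset.sum_comm
    _ = _ := Finset.sum_congr rfl (fun ν _ => CKRST2020.sum_coeff_aeval_monomial e ν (coeff ν g))

end Lemma19Proof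

/-! ### Discharge of `CKRST2020_claim13` (Chinese remaindering, via `2^K ≤ (K+1)·lcm(1..K)`) -/

section Claim13Proof

/-- **Discharge of `CKRST2020_claim13`** (v2 ‹Claim 13› = ECCC/v4 Claim 4.4) with the absolute constant
`C = 3`: if every `r ∈ [2, K]`, `K = 2 log₂ M + 3`, divided `f(a)` then `lcm(1..K) ≤ |f(a)| ≤ M <
2^{log₂ M + 1}`, contradicting `2^K ≤ (K+1)·lcm(1..K)` (Mathlib `Chebyshev.two_pow_le_mul_lcmUpto`, in
place of the print's "lcm of `[ℓ²]` is at least `2^ℓ`"); and `Σ_m coeff_m(f)·(a^m mod r) ≡ f(a) (mod r)`.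
[cite: ChatterjeeKumarRamyaSaptharishiTengse2020, Claim 4.4 (arXiv v4 = ECCC) = v2 ‹Claim 13›] -/
theorem CKRST2020_claim13_holds : CKRST2020_claim13 := by
  classical
  refine ⟨3, fun n f a M hne hM => ?_⟩
  set v : ℤ := eval a f with hv
  set L : ℕ := Nat.log 2 M + 1 with hL
  set K : ℕ := 2 * L + 1 with hK
  have hML : M < 2 ^ L := Nat.lt_pow_succ_log_self one_lt_two M
  have hv1 : v.natAbs ≠ 0 := Int.natAbs_ne_zero.mpr hne
  have hvM : v.natAbs ≤ M := by
    have h := hM; rw [Int.abs_eq_natAbs] at h; exact_mod_cast h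
  -- Step 1: some modulus `r ∈ [2, K]` does not divide `f(a)`
  have hex : ∃ r ∈ Finset.Icc 2 K, ¬ (r ∣ v.natAbs) := by
    by_contra hall
    push Not at hall
    have hdvd : Nat.lcmUpto K ∣ v.natAbs := by
      refine Finset.lcm_dvd (fun b hb => ?_)
      rw [Finset.mem_Icc] at hb
      rcases Nat.eq_or_lt_of_le hb.1 with h1 | h1
      · rw [← h1]; exact one_dvd _
      · exact hall b (Finset.mem_Icc.mpr ⟨h1, hb.2⟩)
    have h1 : Nat.lcmUpto K ≤ M := (Nat.le_of_dvd (Nat.pos_of_ne_zero hv1) hdvd).trans hvM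
    have h2 := Chebyshev.two_pow_le_mul_lcmUpto K
    have hL2 : L + 1 ≤ 2 ^ L := Nat.lt_two_pow_self
    have h3 : (K + 1) * 2 ^ L ≤ 2 ^ K := by
      have : 2 ^ K = 2 ^ L * 2 ^ L * 2 := by rw [hK, pow_succ, two_mul, pow_add]
      rw [this, hK]
      nlinarith
    have h4 : (K + 1) * Nat.lcmUpto K < (K + 1) * 2 ^ L :=
      Nat.mul_lt_mul_of_pos_left (h1.trans_lt hML) (Nat.succ_pos K)
    omega
  obtain ⟨r, hr, hndvd⟩ := hex
  rw [Finset.mem_Icc] at hr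
  refine ⟨r, hr.1, ?_, ?_⟩
  · -- `r ≤ K = 2 log₂ M + 3 ≤ 3 (log₂ M + 1)²`
    calc r ≤ K := hr.2
      _ ≤ 3 * (Nat.log 2 M + 1) ^ 2 := by rw [hK, hL]; nlinarith
  · -- Step 2: `Σ_m coeff_m(f)·(a^m mod r) ≡ f(a) (mod r)`, so it cannot vanish
    intro hS
    apply hndvd
    have hdiff : (r : ℤ) ∣ (∑ m ∈ f.support, coeff m f * ((∏ i, a i ^ m i) % (r : ℤ))) - v := by
      rw [hv, MvPolynomial.eval_eq', ← Finset.sum_sub_distrib]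
      refine Finset.dvd_sum (fun m _ => ?_)
      rw [← mul_sub]
      refine Dvd.dvd.mul_left ?_ _
      rw [Int.emod_def]
      exact ⟨-((∏ i, a i ^ m i) / (r : ℤ)), by ring⟩
    rw [hS, zero_sub, dvd_neg] at hdiff
    exact Int.natCast_dvd.mp hdiff

end Claim13Proof

/-! ### v2 ‹Lemma 12› in the tree frame `d = n` (a PROVED corollary of the named fact) -/

section Lemma12Frame

/-- **v2 ‹Lemma 12› [HS80] in the tree's frame `d = n`, size `n^b`** (the shape the route's
discharge of Theorem 1.6 consumes): for every size exponent `b` there are an exponent `e` and `n₀`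
such that for all `n ≥ n₀` some set of `≤ n^e` integer points in `{1,…,n^e}^n` hits every nonzero
member of `SmallCircuits ℂ n b`. From the fact at `d = n`, `s = n^{b+1}`.
[cite: ChatterjeeKumarRamyaSaptharishiTengse2020, v2 ‹Lemma 12› (§4); cf. Lemma 3.6 (arXiv v4)] -/
-- PROVED (from the fact)
theorem CKRST2020_lemma12.frame (h : CKRST2020_lemma12) (b : ℕ) :
    ∃ e n₀ : ℕ, ∀ n ≥ n₀, ∃ H : Finset (Fin n → ℤ),
      (∀ x ∈ H, ∀ i, 1 ≤ x i ∧ x i ≤ ((n ^ e : ℕ) : ℤ)) ∧ H.card ≤ n ^ e ∧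
        ∀ f ∈ SmallCircuits ℂ n b, f ≠ 0 → ∃ x ∈ H, eval (fun i => (x i : ℂ)) f ≠ 0 := by
  obtain ⟨e, he⟩ := h
  refine ⟨(b + 1) * e + (2 * b + 4), 2, fun n hn => ?_⟩
  have hn1 : 1 ≤ n := by omega
  have hns : n ≤ n ^ (b + 1) := Nat.le_self_pow (by omega) n
  obtain ⟨H, hgrid, hcard, hhit⟩ :=
    he n n (n ^ (b + 1)) hn1 hns hn1 hns (le_trans hn hns)
  refine ⟨H, fun x hx i => ⟨(hgrid x hx i).1, (hgrid x hx i).2.trans ?_⟩, hcard.trans ?_, ?_⟩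
  · have : (n ^ (b + 1) * n) ^ 2 = n ^ (2 * b + 4) := by ring
    rw [this]
    exact_mod_cast Nat.pow_le_pow_right hn1 (by omega)
  · rw [← pow_mul]
    exact Nat.pow_le_pow_right hn1 (by omega)
  · intro f hf hf0
    exact hhit f ⟨hf.1, hf.2.trans (Nat.pow_le_pow_right hn1 (by omega))⟩ hf0

end Lemma12Frame

/-! ### Discharge of `CKRST2020_lemma20` (the universal map for definable polynomials) -/

section Lemma20Proof

namespace CKRST2020

variable {R : Type*} [CommSemiring R] {σ τ : Type*}

/-- `coeff_y (coeff_x (sumAlgEquiv U)) = coeff_{(x, y)} U`.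
[cite: ForbesShpilkaVolk2018, Thm. 12 (seq.), proof] -/
private theorem coeff_coeff_sumAlgEquiv (U : MvPolynomial (σ ⊕ τ) R) (ex : σ →₀ ℕ)
    (ey : τ →₀ ℕ) :
    coeff ey (coeff ex (sumAlgEquiv R σ τ U)) =
      coeff (Finsupp.sumFinsuppAddEquivProdFinsupp.symm (ex, ey)) U := by
  -- adapted from FSV18UniversalConstructionsProofs.lean (private there)
  simp [sumAlgEquiv, coeff, AddMonoidAlgebra.curryAlgEquiv, AddMonoidAlgebra.curryRingEquiv,
    AddMonoidAlgebra.curryAddEquiv, Finsupp.curry_apply]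

/-- Specialising the `y`-variables to constants is `map (eval α)` on the flattening
`R[x ⊕ y] ≃ (R[y])[x]`. [cite: ForbesShpilkaVolk2018, Thm. 12 (seq.), proof] -/
private theorem aeval_sumElim_symm_sumAlgEquiv (α : τ → R)
    (P : MvPolynomial σ (MvPolynomial τ R)) :
    aeval (Sum.elim X fun j => C (α j)) ((sumAlgEquiv R σ τ).symm P) =
      MvPolynomial.map (eval α) P := by
  -- adapted from FSV18UniversalConstructionsProofs.lean (private there)
  set F : MvPolynomial σ (MvPolynomial τ R) →+* MvPolynomial σ R :=
    (aeval (Sum.elim X fun j => C (α j)) :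
        MvPolynomial (σ ⊕ τ) R →ₐ[R] MvPolynomial σ R).toRingHom.comp
      ((sumAlgEquiv R σ τ).symm :
        MvPolynomial σ (MvPolynomial τ R) →ₐ[R] MvPolynomial (σ ⊕ τ) R).toRingHom
    with hF
  have key : F = MvPolynomial.map (eval α) := by
    refine MvPolynomial.ringHom_ext (fun a => ?_) (fun t => ?_)
    · have hc : F.comp (C : MvPolynomial τ R →+* MvPolynomial σ (MvPolynomial τ R)) =
          (C : R →+* MvPolynomial σ R).comp (eval α) := by
        refine MvPolynomial.ringHom_ext (fun c => ?_) (fun l => ?_)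
        · show aeval (Sum.elim X fun j => C (α j)) ((sumAlgEquiv R σ τ).symm (C (C c))) =
            C (eval α (C c))
          rw [sumAlgEquiv_symm_C_C, eval_C, aeval_C, algebraMap_eq]
        · show aeval (Sum.elim X fun j => C (α j)) ((sumAlgEquiv R σ τ).symm (C (X l))) =
            C (eval α (X l))
          rw [sumAlgEquiv_symm_C_X, eval_X, aeval_X, Sum.elim_inr]
      have := RingHom.congr_fun hc a
      show _ = MvPolynomial.map (eval α) (C a)
      rw [map_C]
      exact this
    · show aeval (Sum.elim X fun j => C (α j)) ((sumAlgEquiv R σ τ).symm (X t)) =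
        MvPolynomial.map (eval α) (X t)
      rw [sumAlgEquiv_symm_X, aeval_X, Sum.elim_inl, map_X]
  show F P = _
  rw [key]

/-- `coeff_x U(x, α) = (coeff_x (sumAlgEquiv U))(α)`: the coefficients of a specialisation are
the values of fixed polynomials in the parameters.
[cite: ChatterjeeKumarRamyaSaptharishiTengse2020, Lemma 5.7 (ECCC) = v2 ‹Lemma 20›, proof] -/
private theorem coeff_aeval_sumElim (α : τ → R) (U : MvPolynomial (σ ⊕ τ) R) (m : σ →₀ ℕ) :
    coeff m (aeval (Sum.elim X fun j => C (α j)) U) =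
      eval α (coeff m (sumAlgEquiv R σ τ U)) := by
  conv_lhs => rw [← (sumAlgEquiv R σ τ).symm_apply_apply U]
  rw [aeval_sumElim_symm_sumAlgEquiv, coeff_map]

/-- The `y`-degree of a coefficient of the flattening is at most the total degree.
[cite: ChatterjeeKumarRamyaSaptharishiTengse2020, Lemma 5.7 (ECCC) = v2 ‹Lemma 20›, proof] -/
private theorem totalDegree_coeff_sumAlgEquiv_le (U : MvPolynomial (σ ⊕ τ) R) (m : σ →₀ ℕ) :
    (coeff m (sumAlgEquiv R σ τ U)).totalDegree ≤ U.totalDegree := by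
  rw [totalDegree]
  refine Finset.sup_le fun ey hey => ?_
  have hU : Finsupp.sumFinsuppAddEquivProdFinsupp.symm (m, ey) ∈ U.support := by
    rw [mem_support_iff] at hey ⊢
    rwa [← coeff_coeff_sumAlgEquiv]
  refine le_trans ?_ (le_totalDegree hU)
  simp only [Finsupp.sumFinsuppAddEquivProdFinsupp_symm_apply]
  rw [Finsupp.sum_sumElim]
  exact Nat.le_add_left _ _

/-- Renaming the `x`-variables commutes with specialising the `y`-variables.
[cite: ChatterjeeKumarRamyaSaptharishiTengse2020, Lemma 5.7 (ECCC) = v2 ‹Lemma 20›, proof] -/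
private theorem rename_aeval_sumElim {σ' : Type*} (k : σ → σ') (α : τ → R)
    (U : MvPolynomial (σ ⊕ τ) R) :
    rename k (aeval (Sum.elim X fun j => C (α j)) U) =
      aeval (Sum.elim X fun j => C (α j)) (rename (Sum.map k id) U) := by
  rw [aeval_rename]
  have h := comp_aeval (Sum.elim X fun j => C (α j) : σ ⊕ τ → MvPolynomial σ R)
    (rename k : MvPolynomial σ R →ₐ[R] MvPolynomial σ' R)
  have h' : (fun i => (rename k : MvPolynomial σ R →ₐ[R] MvPolynomial σ' R)
      ((Sum.elim X fun j => C (α j) : σ ⊕ τ → MvPolynomial σ R) i)) =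
      (Sum.elim X fun j => C (α j)) ∘ Sum.map k id := by
    funext i
    cases i with
    | inl a => simp [rename_X]
    | inr b => simp
  show ((rename k : MvPolynomial σ R →ₐ[R] MvPolynomial σ' R).comp
    (aeval (Sum.elim X fun j => C (α j)))) U = _
  rw [h, h']

/-- The parameter count of the universal circuit at `(s, s, s)` is `≤ s^92` for `s ≥ 2`.
[cite: ChatterjeeKumarRamyaSaptharishiTengse2020, Lemma 5.7 (ECCC) = v2 ‹Lemma 20›, proof] -/
private theorem universal_params_le {s : ℕ} (hs : 2 ≤ s) :
    9376 * (s + s + s + 2) ^ 26 ≤ s ^ 92 := by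
  have h1 : s + s + s + 2 ≤ 4 * s := by omega
  have h2 : 9376 ≤ s ^ 14 :=
    calc 9376 ≤ 2 ^ 14 := by norm_num
      _ ≤ s ^ 14 := Nat.pow_le_pow_left hs 14
  have h3 : 4 ≤ s ^ 2 := by nlinarith
  calc 9376 * (s + s + s + 2) ^ 26 ≤ s ^ 14 * (4 * s) ^ 26 :=
        Nat.mul_le_mul h2 (Nat.pow_le_pow_left h1 26)
    _ = s ^ 14 * (4 ^ 26 * s ^ 26) := by rw [mul_pow]
    _ ≤ s ^ 14 * ((s ^ 2) ^ 26 * s ^ 26) :=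
        Nat.mul_le_mul_left _ (Nat.mul_le_mul_right _ (Nat.pow_le_pow_left h3 26))
    _ = s ^ 92 := by ring

/-- `3s + 1 ≤ s^92` for `s ≥ 2`.
[cite: ChatterjeeKumarRamyaSaptharishiTengse2020, Lemma 5.7 (ECCC) = v2 ‹Lemma 20›, proof] -/
private theorem universal_degree_le {s : ℕ} (hs : 2 ≤ s) : 3 * s + 1 ≤ s ^ 92 := by
  have h3 : 4 ≤ s ^ 2 := by nlinarith
  have h4 : 4 * s ≤ s ^ 3 :=
    calc 4 * s ≤ s ^ 2 * s := Nat.mul_le_mul_right _ h3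
      _ = s ^ 3 := by ring
  calc 3 * s + 1 ≤ s ^ 3 := by omega
    _ ≤ s ^ 92 := Nat.pow_le_pow_right (by omega) (by norm_num)

end CKRST2020

/-- **Discharge of `CKRST2020_lemma20`** (v2 ‹Lemma 20› = ECCC Lemma 5.7 = arXiv v4 Lemma 3.5),
following the printed proof: an `s`-definable `f = Σ_{α ∈ {0,1}^m} g(x, α)` has `g` of size and
degree `≤ s` in `s` variables, so `g = U(x, w, β)` is a specialisation of the universal circuit
`U` (`RazUniversal.exists_universalCircuit`, FSV18 Thm. 12 / [Raz10]) with `poly(s)` parameters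
and total degree `≤ 3s + 1`; the coefficients of `g` are then the values at `β` of the fixed
polynomials `coeff_{x^e w^a}(U) ∈ ℂ[y]`, and by ‹Lemma 19› (`CKRST2020_lemma19_holds`)
`coeff_{x^e}(f) = Σ_a 2^{m - |supp a|}·coeff_{x^e w^a}(g)` is the value of the fixed polynomial
`𝒰_e = Σ_a 2^{m - |supp a|}·coeff_{x^e w^a}(U)` of the same degree. Exponent `e = 92`
(`9376·(3s+2)^26 ≤ s^92`). [cite: ChatterjeeKumarRamyaSaptharishiTengse2020, Lemma 5.7 (ECCC) = v2 ‹Lemma 20› = Lemma 3.5 (arXiv v4)] -/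
theorem CKRST2020_lemma20_holds : CKRST2020_lemma20 := by
  classical
  refine ⟨92, fun n d s _h1n hns h2s => ?_⟩
  have hnm : n + (s - n) = s := by omega
  obtain ⟨p, U₀, hp, -, -, hdeg, huniv⟩ :=
    RazUniversal.exists_universalCircuit ℂ (n + (s - n)) s s
  -- transport the `x`-variables `Fin (n + (s - n))` to `Fin n ⊕ Fin (s - n)`
  set e : Fin n ⊕ Fin (s - n) ≃ Fin (n + (s - n)) := finSumFinEquiv with he
  set U₁ : MvPolynomial ((Fin n ⊕ Fin (s - n)) ⊕ Fin p) ℂ := rename (Sum.map e.symm id) U₀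
    with hU₁
  set V := sumAlgEquiv ℂ (Fin n ⊕ Fin (s - n)) (Fin p) U₁ with hV
  -- the universal map `𝒰_μ = Σ_{ν ∈ supp V, ν_x = μ} 2^{m - |supp ν_w|} · coeff_ν V ∈ ℂ[y]`
  refine ⟨p, fun μ => ∑ ν ∈ V.support,
      if (Finsupp.sumFinsuppEquivProdFinsupp ν).1 = (μ : Fin n →₀ ℕ) then
        C ((2 : ℂ) ^ ((s - n) - (Finsupp.sumFinsuppEquivProdFinsupp ν).2.support.card)) *
          coeff ν V
      else 0, ?_, ?_, ?_⟩
  · -- parameter count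
    calc p ≤ 9376 * (n + (s - n) + s + s + 2) ^ 26 := hp
      _ ≤ s ^ 92 := by rw [hnm]; exact CKRST2020.universal_params_le h2s
  · -- degrees
    intro μ
    refine totalDegree_finsetSum_le fun ν _ => ?_
    split_ifs
    · calc (C _ * coeff ν V).totalDegree ≤ (C _).totalDegree + (coeff ν V).totalDegree :=
            totalDegree_mul _ _
        _ = (coeff ν V).totalDegree := by rw [totalDegree_C, zero_add]
        _ ≤ U₁.totalDegree := CKRST2020.totalDegree_coeff_sumAlgEquiv_le U₁ ν
        _ ≤ U₀.totalDegree := totalDegree_rename_le _ _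
        _ ≤ 3 * s + 1 := hdeg
        _ ≤ s ^ 92 := CKRST2020.universal_degree_le h2s
    · rw [totalDegree_zero]; exact Nat.zero_le _
  · -- universality on the definable slice
    rintro f ⟨-, -, g, hgdeg, hgc, rfl⟩
    have hg'c : complexity (rename e g) ≤ s := by
      rw [complexity_rename_of_injective_holds e.injective g]; exact hgc
    have hg'd : (rename e g).totalDegree ≤ s := (totalDegree_rename_le _ _).trans hgdeg
    obtain ⟨α, hα⟩ := huniv (rename e g) hg'd hg'c
    have hg : aeval (Sum.elim X fun j => C (α j)) U₁ = g := by
      rw [hU₁, ← CKRST2020.rename_aeval_sumElim, hα, rename_rename, e.symm_comp_self, rename_id_apply]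
    refine ⟨α, fun μ => ?_⟩
    show _ = coeff (μ : Fin n →₀ ℕ) (boolSum g)
    rw [CKRST2020_lemma19_holds ℂ n (s - n) g μ, map_sum]
    have hcoeff : ∀ ν, eval α (coeff ν V) = coeff ν g := fun ν => by
      rw [hV, ← CKRST2020.coeff_aeval_sumElim, hg]
    symm
    refine Finset.sum_subset (fun ν hν => ?_) (fun ν _ hν => ?_) |>.trans
      (Finset.sum_congr rfl fun ν _ => ?_)
    · -- `supp g ⊆ supp V`
      rw [mem_support_iff] at hν ⊢
      intro h0
      exact hν (by rw [← hcoeff, h0, map_zero])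
    · rw [notMem_support_iff] at hν
      rw [hν, mul_zero, ite_self]
    · split_ifs with h
      · rw [map_mul, eval_C, hcoeff]
      · rw [map_zero]

end Lemma20Proof

end Literature.Barriers.ValiantsHypothesis
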